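import Literature.Combinatorics.Optimization.ShellLawCentredMomentLevelStep
import HarnessLib

/-!
# Cell pnp-psdrank, route `ChebyshevTracialDesign`: termwise and summed bounds for the Leibniz split of the centred second moment
# (crux `TracialDecayExp20`, stmt-PneNP-19878)

Brick 135 (eng g25; MEMO-24 (eng) §2b/§3, MEMO-29 (prover g26) §3b (B4)). Prover g27's `Literature …ShellLawCentredMomentLevelStep` (p679219) proves that
the level differences of a quadratically weighted section `F(j) = E_{c₀+2j}[1_{X=x}(u₂n_A(n_A−1) + u₁n_A + u₀)]` — in particular of the centred second moment
`A^m_c(x)` of brick 130's hypothesis (ii), `(u₂,u₁,u₀) = (1, 1−2m, m²)` — are, at EVERY order `k`, the finite Leibniz split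
(`ShellStep.fwdDiff_iter_threeLaw_eq`, Boole's truncated rule for the quadratic / linear pinning polynomials)

  `Δ^kF(0) = u₂·(T(T−2)/K·Δ^kG₂(0) − k·(4(T−2)/K)·Δ^{k−1}G₂(1) + C(k,2)·(8/K)·Δ^{k−2}G₂(2)) + u₁·(T/K₁·Δ^kG₁(0) − k·(2/K₁)·Δ^{k−1}G₁(1)) + u₀·Δ^kG₀(0)`

with the three plain law profiles `G₂, G₁, G₀` (twice / once pinned / unpinned ground sets). This file supplies the BOOKKEEPING that turns the split into
brick 130's currency `Σ_{k=1}^{D} c_k|Δ^k F(0)|`, `c_k = C(2k,k)/4^k`, for the orders `k ≥ 2` (the order `k = 1` is the transported level step, prover g27's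
`levelStep_centredSecond_eq`, and is NOT bounded here):
* §1 node shifts `Δ^i f(y+1) = Δ^i f(y) + Δ^{i+1} f(y)`, `Δ^i f(y+2) = Δ^i f(y) + 2Δ^{i+1}f(y) + Δ^{i+2}f(y)`;
* §2 `abs_fwdDiff_iter_threeLaw_le` — the TERMWISE absolute bound of the split (`2 ≤ T`, `0 < K, K₁`; no cancellation used), and
  `abs_fwdDiff_iter_threeLaw_le_base` — the same with all differences moved to the base node `0` (`k ≥ 2`); the `k = 2` term `C(2,2)·(8/K)·G₂(0)`-type
  piece carries NO difference of any law: the reason the exact numerics (eng g25, kit j320157, MEMO-24 §2 (E3.2)) see `|Δ²A^m|/A^m_1 = Θ(1/N)`, not `Θ(1/N²)`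
  — a per-order hypothesis of shape `(C/N)^k` would be false; the criterion SUM is `Θ(1/N)`;
* §3 `centralCoeff_succ_le` / `centralCoeff_antitone` (`c_{k+1} ≤ c_k`) and **`sum_abs_fwdDiff_iter_threeLaw_le`**: given per-order smoothness budgets
  `c_i|Δ^iG_r(0)| ≤ R_r(i)` (`i ≤ D`; the tree's `abs_fwdDiff_iter_shellLaw_le_of_hyps` supplies `R(i) = Γq^i·law₁ + tail_i`),
  `Σ_{k=2}^{D} c_k|Δ^kF(0)| ≤ Σ_{k=2}^{D} [ |u₂|(T(T−2)/K·R₂(k) + 4k(T−2)/K·(R₂(k−1)+R₂(k)) + 8C(k,2)/K·(R₂(k−2)+2R₂(k−1)+R₂(k))) + |u₁|(T/K₁·R₁(k) + 2k/K₁·(R₁(k−1)+R₁(k))) + |u₀|·R₀(k) ]`.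
NUMERICS (MEMO-24 §2b (E3.8), exact ℚ, N ≤ 1536): this termwise route from `k = 2` costs `N·Σ_{k≥2} c_k TW_k → 4` for the product-like types but `≈ 150–200` (N-flat) for the
generic type `hhrich` (true value `≈ 9`): asymptotically admissible, effectively poor; from `k = 3` it is `≤ 3.4/N` in every class.
WHAT THIS FILE DOES NOT DO: bound the `k = 1` (or a sharper `k = 2`) difference, prove any smoothness of the laws, or anything on `TracialDecayExp20` itself,
psd rank of P_PM(K_n), or P vs NP. [cite: Boole2009, Ch. II Art. 10 Ex. 3 eq. (8) (PDF pp. 34–35)] [cite: Agarwal2000DifferenceEquations, Thm. 1.8.5 (1.8.6)]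
Stature: support/instrument (kernel lane, no defs, axioms standard). Supports stmt-PneNP-19878.
-/

set_option linter.dupNamespace false -- `Summit.PneNP.PneNP.…`: summit = sub-problem (D-0017)

noncomputable section

namespace Summit.PneNP.PneNP.Theorems.ChebyshevTracialDesignGammaDirectionLeibnizBounds

open Finset Literature.Combinatorics.Optimization
open Literature.Combinatorics.Optimization.ShellStep (fwdDiff_iter_threeLaw_eq)

/-! ### §1 Node shifts -/

/-- **Node shift by one**: `Δ^i f(y+1) = Δ^i f(y) + Δ^{i+1} f(y)`. [cite: Boole2009, Ch. II Art. 10 Ex. 3 eq. (8) (PDF pp. 34–35)] -/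
theorem fwdDiff_iter_apply_succ (f : ℕ → ℝ) (i y : ℕ) :
    (fwdDiff (1 : ℕ))^[i] f (y + 1) = (fwdDiff (1 : ℕ))^[i] f y + (fwdDiff (1 : ℕ))^[i + 1] f y := by
  rw [Function.iterate_succ_apply', fwdDiff]
  ring

/-- **Node shift by two**: `Δ^i f(y+2) = Δ^i f(y) + 2·Δ^{i+1} f(y) + Δ^{i+2} f(y)`. [cite: Boole2009, Ch. II Art. 10 Ex. 3 eq. (8) (PDF pp. 34–35)] -/
theorem fwdDiff_iter_apply_succ_succ (f : ℕ → ℝ) (i y : ℕ) :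
    (fwdDiff (1 : ℕ))^[i] f (y + 1 + 1) =
      (fwdDiff (1 : ℕ))^[i] f y + 2 * (fwdDiff (1 : ℕ))^[i + 1] f y + (fwdDiff (1 : ℕ))^[i + 1 + 1] f y := by
  rw [fwdDiff_iter_apply_succ f i (y + 1), fwdDiff_iter_apply_succ f i y, fwdDiff_iter_apply_succ f (i + 1) y]
  ring

/-! ### §2 The termwise bound of the Leibniz split -/

/-- **Termwise absolute bound of the Leibniz split** (`2 ≤ T`, `0 < K`, `0 < K₁`; no cancellation used): in the setting of
`ShellStep.fwdDiff_iter_threeLaw_eq`,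
`|Δ^kF(0)| ≤ |u₂|·(T(T−2)/K·|Δ^kG₂(0)| + 4k(T−2)/K·|Δ^{k−1}G₂(1)| + 8C(k,2)/K·|Δ^{k−2}G₂(2)|) + |u₁|·(T/K₁·|Δ^kG₁(0)| + 2k/K₁·|Δ^{k−1}G₁(1)|) + |u₀|·|Δ^kG₀(0)|`.
(Meant for `k ≥ 2`; at `k = 1` the three-law combination cancels — `ShellStep.levelStep_centredSecond_eq` — and this bound is void.)
[cite: Boole2009, Ch. II Art. 10 Ex. 3 eq. (8) (PDF pp. 34–35)] -/
theorem abs_fwdDiff_iter_threeLaw_le (F G₂ G₁ G₀ : ℕ → ℝ) (T K K₁ u₂ u₁ u₀ : ℝ) (hT : 2 ≤ T) (hK : 0 < K) (hK₁ : 0 < K₁) (k : ℕ)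
    (hF : ∀ j, j ≤ k → F j =
      u₂ * (((T - 2 * (j : ℝ)) * (T - 2 - 2 * (j : ℝ))) / K) * G₂ j + u₁ * ((T - 2 * (j : ℝ)) / K₁) * G₁ j + u₀ * G₀ j) :
    |(fwdDiff (1 : ℕ))^[k] F 0| ≤
      |u₂| * (T * (T - 2) / K * |(fwdDiff (1 : ℕ))^[k] G₂ 0| + 4 * (k : ℝ) * (T - 2) / K * |(fwdDiff (1 : ℕ))^[k - 1] G₂ 1|
          + 8 * ((k.choose 2 : ℕ) : ℝ) / K * |(fwdDiff (1 : ℕ))^[k - 2] G₂ 2|)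
        + |u₁| * (T / K₁ * |(fwdDiff (1 : ℕ))^[k] G₁ 0| + 2 * (k : ℝ) / K₁ * |(fwdDiff (1 : ℕ))^[k - 1] G₁ 1|)
        + |u₀| * |(fwdDiff (1 : ℕ))^[k] G₀ 0| := by
  rw [fwdDiff_iter_threeLaw_eq F G₂ G₁ G₀ T K K₁ u₂ u₁ u₀ k hF]
  set d₂₀ := (fwdDiff (1 : ℕ))^[k] G₂ 0
  set d₂₁ := (fwdDiff (1 : ℕ))^[k - 1] G₂ 1
  set d₂₂ := (fwdDiff (1 : ℕ))^[k - 2] G₂ 2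
  set d₁₀ := (fwdDiff (1 : ℕ))^[k] G₁ 0
  set d₁₁ := (fwdDiff (1 : ℕ))^[k - 1] G₁ 1
  set d₀₀ := (fwdDiff (1 : ℕ))^[k] G₀ 0
  have hT0 : 0 ≤ T := by linarith
  have hT2 : 0 ≤ T - 2 := by linarith
  have c₁ : 0 ≤ T * (T - 2) / K := div_nonneg (mul_nonneg hT0 hT2) hK.le
  have c₂ : 0 ≤ 4 * (k : ℝ) * (T - 2) / K := div_nonneg (by positivity) hK.le
  have c₃ : 0 ≤ 8 * ((k.choose 2 : ℕ) : ℝ) / K := div_nonneg (by positivity) hK.le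
  have c₄ : 0 ≤ T / K₁ := div_nonneg hT0 hK₁.le
  have c₅ : 0 ≤ 2 * (k : ℝ) / K₁ := div_nonneg (by positivity) hK₁.le
  -- the three groups
  have g₂ : |T * (T - 2) / K * d₂₀ + (k : ℝ) * (-(4 * (T - 2)) / K) * d₂₁ + ((k.choose 2 : ℕ) : ℝ) * (8 / K) * d₂₂| ≤
      T * (T - 2) / K * |d₂₀| + 4 * (k : ℝ) * (T - 2) / K * |d₂₁| + 8 * ((k.choose 2 : ℕ) : ℝ) / K * |d₂₂| := by
    have e₁ : |T * (T - 2) / K * d₂₀| = T * (T - 2) / K * |d₂₀| := by rw [abs_mul, abs_of_nonneg c₁]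
    have e₂ : |(k : ℝ) * (-(4 * (T - 2)) / K) * d₂₁| = 4 * (k : ℝ) * (T - 2) / K * |d₂₁| := by
      rw [abs_mul, show (k : ℝ) * (-(4 * (T - 2)) / K) = -(4 * (k : ℝ) * (T - 2) / K) by ring, abs_neg, abs_of_nonneg c₂]
    have e₃ : |((k.choose 2 : ℕ) : ℝ) * (8 / K) * d₂₂| = 8 * ((k.choose 2 : ℕ) : ℝ) / K * |d₂₂| := by
      rw [abs_mul, show ((k.choose 2 : ℕ) : ℝ) * (8 / K) = 8 * ((k.choose 2 : ℕ) : ℝ) / K by ring, abs_of_nonneg c₃]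
    have h₁ := abs_add_le (T * (T - 2) / K * d₂₀ + (k : ℝ) * (-(4 * (T - 2)) / K) * d₂₁) (((k.choose 2 : ℕ) : ℝ) * (8 / K) * d₂₂)
    have h₂ := abs_add_le (T * (T - 2) / K * d₂₀) ((k : ℝ) * (-(4 * (T - 2)) / K) * d₂₁)
    linarith
  have g₁ : |T / K₁ * d₁₀ + (k : ℝ) * (-2 / K₁) * d₁₁| ≤ T / K₁ * |d₁₀| + 2 * (k : ℝ) / K₁ * |d₁₁| := by
    have e₄ : |T / K₁ * d₁₀| = T / K₁ * |d₁₀| := by rw [abs_mul, abs_of_nonneg c₄]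
    have e₅ : |(k : ℝ) * (-2 / K₁) * d₁₁| = 2 * (k : ℝ) / K₁ * |d₁₁| := by
      rw [abs_mul, show (k : ℝ) * (-2 / K₁) = -(2 * (k : ℝ) / K₁) by ring, abs_neg, abs_of_nonneg c₅]
    have h₃ := abs_add_le (T / K₁ * d₁₀) ((k : ℝ) * (-2 / K₁) * d₁₁)
    linarith
  have m₂ := mul_le_mul_of_nonneg_left g₂ (abs_nonneg u₂)
  have m₁ := mul_le_mul_of_nonneg_left g₁ (abs_nonneg u₁)
  have p₂ : |u₂ * (T * (T - 2) / K * d₂₀ + (k : ℝ) * (-(4 * (T - 2)) / K) * d₂₁ + ((k.choose 2 : ℕ) : ℝ) * (8 / K) * d₂₂)| =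
      |u₂| * |T * (T - 2) / K * d₂₀ + (k : ℝ) * (-(4 * (T - 2)) / K) * d₂₁ + ((k.choose 2 : ℕ) : ℝ) * (8 / K) * d₂₂| := abs_mul _ _
  have p₁ : |u₁ * (T / K₁ * d₁₀ + (k : ℝ) * (-2 / K₁) * d₁₁)| = |u₁| * |T / K₁ * d₁₀ + (k : ℝ) * (-2 / K₁) * d₁₁| := abs_mul _ _
  have p₀ : |u₀ * d₀₀| = |u₀| * |d₀₀| := abs_mul _ _
  have h₄ := abs_add_le (u₂ * (T * (T - 2) / K * d₂₀ + (k : ℝ) * (-(4 * (T - 2)) / K) * d₂₁ + ((k.choose 2 : ℕ) : ℝ) * (8 / K) * d₂₂) +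
      u₁ * (T / K₁ * d₁₀ + (k : ℝ) * (-2 / K₁) * d₁₁)) (u₀ * d₀₀)
  have h₅ := abs_add_le (u₂ * (T * (T - 2) / K * d₂₀ + (k : ℝ) * (-(4 * (T - 2)) / K) * d₂₁ + ((k.choose 2 : ℕ) : ℝ) * (8 / K) * d₂₂))
      (u₁ * (T / K₁ * d₁₀ + (k : ℝ) * (-2 / K₁) * d₁₁))
  linarith

/-- **Termwise bound at the base** (`2 ≤ k`): moving the nodes `1, 2` to `0` by §1,
`|Δ^kF(0)| ≤ |u₂|·(T(T−2)/K·|Δ^kG₂| + 4k(T−2)/K·(|Δ^{k−1}G₂| + |Δ^kG₂|) + 8C(k,2)/K·(|Δ^{k−2}G₂| + 2|Δ^{k−1}G₂| + |Δ^kG₂|))`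
`         + |u₁|·(T/K₁·|Δ^kG₁| + 2k/K₁·(|Δ^{k−1}G₁| + |Δ^kG₁|)) + |u₀|·|Δ^kG₀|`, all differences at the node `0`.
At `k = 2` the piece `8C(2,2)/K·|Δ^0 G₂(0)| = (8/K)·|G₂(0)|` carries no difference of any law (MEMO-24 §2 (E3.2)).
[cite: Boole2009, Ch. II Art. 10 Ex. 3 eq. (8) (PDF pp. 34–35)] -/
theorem abs_fwdDiff_iter_threeLaw_le_base (F G₂ G₁ G₀ : ℕ → ℝ) (T K K₁ u₂ u₁ u₀ : ℝ) (hT : 2 ≤ T) (hK : 0 < K) (hK₁ : 0 < K₁)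
    {k : ℕ} (hk : 2 ≤ k)
    (hF : ∀ j, j ≤ k → F j =
      u₂ * (((T - 2 * (j : ℝ)) * (T - 2 - 2 * (j : ℝ))) / K) * G₂ j + u₁ * ((T - 2 * (j : ℝ)) / K₁) * G₁ j + u₀ * G₀ j) :
    |(fwdDiff (1 : ℕ))^[k] F 0| ≤
      |u₂| * (T * (T - 2) / K * |(fwdDiff (1 : ℕ))^[k] G₂ 0|
          + 4 * (k : ℝ) * (T - 2) / K * (|(fwdDiff (1 : ℕ))^[k - 1] G₂ 0| + |(fwdDiff (1 : ℕ))^[k] G₂ 0|)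
          + 8 * ((k.choose 2 : ℕ) : ℝ) / K *
              (|(fwdDiff (1 : ℕ))^[k - 2] G₂ 0| + 2 * |(fwdDiff (1 : ℕ))^[k - 1] G₂ 0| + |(fwdDiff (1 : ℕ))^[k] G₂ 0|))
        + |u₁| * (T / K₁ * |(fwdDiff (1 : ℕ))^[k] G₁ 0|
          + 2 * (k : ℝ) / K₁ * (|(fwdDiff (1 : ℕ))^[k - 1] G₁ 0| + |(fwdDiff (1 : ℕ))^[k] G₁ 0|))
        + |u₀| * |(fwdDiff (1 : ℕ))^[k] G₀ 0| := by
  obtain ⟨i, rfl⟩ : ∃ i, k = i + 1 + 1 := ⟨k - 2, by omega⟩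
  have hb := abs_fwdDiff_iter_threeLaw_le F G₂ G₁ G₀ T K K₁ u₂ u₁ u₀ hT hK hK₁ (i + 1 + 1) hF
  have s₁ : i + 1 + 1 - 1 = i + 1 := rfl
  have s₂ : i + 1 + 1 - 2 = i := rfl
  rw [s₁, s₂] at hb
  rw [s₁, s₂]
  have n₂₁ : |(fwdDiff (1 : ℕ))^[i + 1] G₂ 1| ≤ |(fwdDiff (1 : ℕ))^[i + 1] G₂ 0| + |(fwdDiff (1 : ℕ))^[i + 1 + 1] G₂ 0| := by
    rw [show (1 : ℕ) = 0 + 1 from rfl, fwdDiff_iter_apply_succ G₂ (i + 1) 0]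
    exact abs_add_le _ _
  have n₁₁ : |(fwdDiff (1 : ℕ))^[i + 1] G₁ 1| ≤ |(fwdDiff (1 : ℕ))^[i + 1] G₁ 0| + |(fwdDiff (1 : ℕ))^[i + 1 + 1] G₁ 0| := by
    rw [show (1 : ℕ) = 0 + 1 from rfl, fwdDiff_iter_apply_succ G₁ (i + 1) 0]
    exact abs_add_le _ _
  have n₂₂ : |(fwdDiff (1 : ℕ))^[i] G₂ 2| ≤
      |(fwdDiff (1 : ℕ))^[i] G₂ 0| + 2 * |(fwdDiff (1 : ℕ))^[i + 1] G₂ 0| + |(fwdDiff (1 : ℕ))^[i + 1 + 1] G₂ 0| := by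
    rw [show (2 : ℕ) = 0 + 1 + 1 from rfl, fwdDiff_iter_apply_succ_succ G₂ i 0]
    calc |(fwdDiff (1 : ℕ))^[i] G₂ 0 + 2 * (fwdDiff (1 : ℕ))^[i + 1] G₂ 0 + (fwdDiff (1 : ℕ))^[i + 1 + 1] G₂ 0|
        ≤ |(fwdDiff (1 : ℕ))^[i] G₂ 0 + 2 * (fwdDiff (1 : ℕ))^[i + 1] G₂ 0| + |(fwdDiff (1 : ℕ))^[i + 1 + 1] G₂ 0| := abs_add_le _ _
      _ ≤ |(fwdDiff (1 : ℕ))^[i] G₂ 0| + |2 * (fwdDiff (1 : ℕ))^[i + 1] G₂ 0| + |(fwdDiff (1 : ℕ))^[i + 1 + 1] G₂ 0| := by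
          linarith [abs_add_le ((fwdDiff (1 : ℕ))^[i] G₂ 0) (2 * (fwdDiff (1 : ℕ))^[i + 1] G₂ 0)]
      _ = _ := by rw [abs_mul, abs_two]
  have hT2 : 0 ≤ T - 2 := by linarith
  have hT0 : 0 ≤ T := by linarith
  have c₂ : 0 ≤ 4 * ((i + 1 + 1 : ℕ) : ℝ) * (T - 2) / K := div_nonneg (by positivity) hK.le
  have c₃ : 0 ≤ 8 * (((i + 1 + 1).choose 2 : ℕ) : ℝ) / K := div_nonneg (by positivity) hK.le
  have c₅ : 0 ≤ 2 * ((i + 1 + 1 : ℕ) : ℝ) / K₁ := div_nonneg (by positivity) hK₁.le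
  have m₂ := mul_le_mul_of_nonneg_left n₂₁ c₂
  have m₃ := mul_le_mul_of_nonneg_left n₂₂ c₃
  have m₅ := mul_le_mul_of_nonneg_left n₁₁ c₅
  have q₂ := mul_le_mul_of_nonneg_left (add_le_add (add_le_add_left m₂ (T * (T - 2) / K * |(fwdDiff (1 : ℕ))^[i + 1 + 1] G₂ 0|)) m₃)
    (abs_nonneg u₂)
  have q₁ := mul_le_mul_of_nonneg_left (add_le_add_left m₅ (T / K₁ * |(fwdDiff (1 : ℕ))^[i + 1 + 1] G₁ 0|)) (abs_nonneg u₁)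
  linarith

/-! ### §3 The summed form over the orders `2 ≤ k ≤ D` (brick 130's currency) -/

/-- `c_k = C(2k,k)/4^k` is antitone in one step: `c_{k+1} = ((2k+1)/(2k+2))·c_k ≤ c_k`. [cite: Agarwal2000DifferenceEquations, Thm. 1.8.5 (1.8.6)] -/
theorem centralCoeff_succ_le (k : ℕ) :
    (((2 * (k + 1)).choose (k + 1) : ℕ) : ℝ) / (4 : ℝ) ^ (k + 1) ≤ (((2 * k).choose k : ℕ) : ℝ) / (4 : ℝ) ^ k := by
  rw [← Nat.centralBinom_eq_two_mul_choose, ← Nat.centralBinom_eq_two_mul_choose]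
  have h : ((k : ℝ) + 1) * (Nat.centralBinom (k + 1) : ℝ) = 2 * (2 * (k : ℝ) + 1) * (Nat.centralBinom k : ℝ) := by
    exact_mod_cast Nat.succ_mul_centralBinom_succ k
  have hC : (0 : ℝ) ≤ (Nat.centralBinom k : ℝ) := Nat.cast_nonneg _
  have hC' : (Nat.centralBinom (k + 1) : ℝ) ≤ 4 * (Nat.centralBinom k : ℝ) := by
    have hk : (0 : ℝ) < (k : ℝ) + 1 := by positivity
    have : ((k : ℝ) + 1) * (Nat.centralBinom (k + 1) : ℝ) ≤ ((k : ℝ) + 1) * (4 * (Nat.centralBinom k : ℝ)) := by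
      rw [h]; nlinarith
    exact le_of_mul_le_mul_left this hk
  rw [pow_succ, mul_comm ((4 : ℝ) ^ k) 4, ← div_div]
  have h4 : (Nat.centralBinom (k + 1) : ℝ) / 4 ≤ (Nat.centralBinom k : ℝ) := by linarith
  gcongr

/-- `c_k = C(2k,k)/4^k` is antitone: `c_i ≤ c_j` for `j ≤ i`. [cite: Agarwal2000DifferenceEquations, Thm. 1.8.5 (1.8.6)] -/
theorem centralCoeff_antitone {i j : ℕ} (hji : j ≤ i) :
    (((2 * i).choose i : ℕ) : ℝ) / (4 : ℝ) ^ i ≤ (((2 * j).choose j : ℕ) : ℝ) / (4 : ℝ) ^ j := by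
  have hanti : Antitone fun k : ℕ => (((2 * k).choose k : ℕ) : ℝ) / (4 : ℝ) ^ k :=
    antitone_nat_of_succ_le fun k => centralCoeff_succ_le k
  exact hanti hji

/-- **The summed termwise bound, orders `2 ≤ k ≤ D`.** In the setting of `abs_fwdDiff_iter_threeLaw_le_base` (split valid on the nodes `0..D`), suppose the
three law profiles come with per-order smoothness budgets at the base: `c_i·|Δ^i G_r(0)| ≤ R_r(i)` for all `i ≤ D` (`r = 0,1,2`; at `i = 0` this reads `|G_r(0)| ≤ R_r(0)`).
Then `Σ_{k=2}^{D} c_k|Δ^kF(0)| ≤ Σ_{k=2}^{D} [ |u₂|·(T(T−2)/K·R₂(k) + 4k(T−2)/K·(R₂(k−1)+R₂(k)) + 8C(k,2)/K·(R₂(k−2)+2R₂(k−1)+R₂(k)))`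
`                                 + |u₁|·(T/K₁·R₁(k) + 2k/K₁·(R₁(k−1)+R₁(k))) + |u₀|·R₀(k) ]`
(`c_k ≤ c_{k−1} ≤ c_{k−2}` moves the weight onto the lower-order differences). With the `k = 1` term (prover g27's transported level step) added this is
the left side of brick 130's hypothesis `(hA)`. [cite: Boole2009, Ch. II Art. 10 Ex. 3 eq. (8) (PDF pp. 34–35)] -/
theorem sum_abs_fwdDiff_iter_threeLaw_le (F G₂ G₁ G₀ : ℕ → ℝ) (T K K₁ u₂ u₁ u₀ : ℝ) (hT : 2 ≤ T) (hK : 0 < K) (hK₁ : 0 < K₁) (D : ℕ)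
    (hF : ∀ j, j ≤ D → F j =
      u₂ * (((T - 2 * (j : ℝ)) * (T - 2 - 2 * (j : ℝ))) / K) * G₂ j + u₁ * ((T - 2 * (j : ℝ)) / K₁) * G₁ j + u₀ * G₀ j)
    (R₀ R₁ R₂ : ℕ → ℝ)
    (hR₀ : ∀ i, i ≤ D → (((2 * i).choose i : ℕ) : ℝ) / (4 : ℝ) ^ i * |(fwdDiff (1 : ℕ))^[i] G₀ 0| ≤ R₀ i)
    (hR₁ : ∀ i, i ≤ D → (((2 * i).choose i : ℕ) : ℝ) / (4 : ℝ) ^ i * |(fwdDiff (1 : ℕ))^[i] G₁ 0| ≤ R₁ i)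
    (hR₂ : ∀ i, i ≤ D → (((2 * i).choose i : ℕ) : ℝ) / (4 : ℝ) ^ i * |(fwdDiff (1 : ℕ))^[i] G₂ 0| ≤ R₂ i) :
    ∑ k ∈ Ico 2 (D + 1), (((2 * k).choose k : ℕ) : ℝ) / (4 : ℝ) ^ k * |(fwdDiff (1 : ℕ))^[k] F 0| ≤
      ∑ k ∈ Ico 2 (D + 1), (|u₂| * (T * (T - 2) / K * R₂ k + 4 * (k : ℝ) * (T - 2) / K * (R₂ (k - 1) + R₂ k)
          + 8 * ((k.choose 2 : ℕ) : ℝ) / K * (R₂ (k - 2) + 2 * R₂ (k - 1) + R₂ k))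
        + |u₁| * (T / K₁ * R₁ k + 2 * (k : ℝ) / K₁ * (R₁ (k - 1) + R₁ k)) + |u₀| * R₀ k) := by
  refine sum_le_sum fun k hk => ?_
  rw [mem_Ico] at hk
  obtain ⟨hk2, hkD⟩ := hk
  have hkD' : k ≤ D := Nat.lt_succ_iff.1 hkD
  set ck := (((2 * k).choose k : ℕ) : ℝ) / (4 : ℝ) ^ k with hck
  have hck0 : 0 ≤ ck := by positivity
  have hb := mul_le_mul_of_nonneg_left
    (abs_fwdDiff_iter_threeLaw_le_base F G₂ G₁ G₀ T K K₁ u₂ u₁ u₀ hT hK hK₁ hk2 (fun j hj => hF j (hj.trans hkD'))) hck0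
  set u₂₀ := |(fwdDiff (1 : ℕ))^[k] G₂ 0|
  set u₂₁ := |(fwdDiff (1 : ℕ))^[k - 1] G₂ 0|
  set u₂₂ := |(fwdDiff (1 : ℕ))^[k - 2] G₂ 0|
  set u₁₀ := |(fwdDiff (1 : ℕ))^[k] G₁ 0|
  set u₁₁ := |(fwdDiff (1 : ℕ))^[k - 1] G₁ 0|
  set u₀₀ := |(fwdDiff (1 : ℕ))^[k] G₀ 0|
  have hdist : ck * (|u₂| * (T * (T - 2) / K * u₂₀ + 4 * (k : ℝ) * (T - 2) / K * (u₂₁ + u₂₀)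
        + 8 * ((k.choose 2 : ℕ) : ℝ) / K * (u₂₂ + 2 * u₂₁ + u₂₀))
      + |u₁| * (T / K₁ * u₁₀ + 2 * (k : ℝ) / K₁ * (u₁₁ + u₁₀)) + |u₀| * u₀₀) =
      |u₂| * (T * (T - 2) / K * (ck * u₂₀) + 4 * (k : ℝ) * (T - 2) / K * (ck * u₂₁ + ck * u₂₀)
        + 8 * ((k.choose 2 : ℕ) : ℝ) / K * (ck * u₂₂ + 2 * (ck * u₂₁) + ck * u₂₀))
      + |u₁| * (T / K₁ * (ck * u₁₀) + 2 * (k : ℝ) / K₁ * (ck * u₁₁ + ck * u₁₀)) + |u₀| * (ck * u₀₀) := by ring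
  rw [hdist] at hb
  -- move `c_k` onto each difference and use the budgets (antitone `c`)
  have hc1 : ck ≤ (((2 * (k - 1)).choose (k - 1) : ℕ) : ℝ) / (4 : ℝ) ^ (k - 1) := centralCoeff_antitone (by omega)
  have hc2 : ck ≤ (((2 * (k - 2)).choose (k - 2) : ℕ) : ℝ) / (4 : ℝ) ^ (k - 2) := centralCoeff_antitone (by omega)
  have b₂₀ : ck * u₂₀ ≤ R₂ k := hR₂ k hkD'
  have b₂₁ : ck * u₂₁ ≤ R₂ (k - 1) := (mul_le_mul_of_nonneg_right hc1 (abs_nonneg _)).trans (hR₂ (k - 1) (by omega))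
  have b₂₂ : ck * u₂₂ ≤ R₂ (k - 2) := (mul_le_mul_of_nonneg_right hc2 (abs_nonneg _)).trans (hR₂ (k - 2) (by omega))
  have b₁₀ : ck * u₁₀ ≤ R₁ k := hR₁ k hkD'
  have b₁₁ : ck * u₁₁ ≤ R₁ (k - 1) := (mul_le_mul_of_nonneg_right hc1 (abs_nonneg _)).trans (hR₁ (k - 1) (by omega))
  have b₀₀ : ck * u₀₀ ≤ R₀ k := hR₀ k hkD'
  have hT0 : 0 ≤ T := by linarith
  have hT2 : 0 ≤ T - 2 := by linarith
  have c₁ : 0 ≤ T * (T - 2) / K := div_nonneg (mul_nonneg hT0 hT2) hK.le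
  have c₂ : 0 ≤ 4 * (k : ℝ) * (T - 2) / K := div_nonneg (by positivity) hK.le
  have c₃ : 0 ≤ 8 * ((k.choose 2 : ℕ) : ℝ) / K := div_nonneg (by positivity) hK.le
  have c₄ : 0 ≤ T / K₁ := div_nonneg hT0 hK₁.le
  have c₅ : 0 ≤ 2 * (k : ℝ) / K₁ := div_nonneg (by positivity) hK₁.le
  have m₁ := mul_le_mul_of_nonneg_left b₂₀ c₁
  have m₂ := mul_le_mul_of_nonneg_left (add_le_add b₂₁ b₂₀) c₂
  have m₃ := mul_le_mul_of_nonneg_left (add_le_add (add_le_add b₂₂ (mul_le_mul_of_nonneg_left b₂₁ zero_le_two)) b₂₀) c₃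
  have m₄ := mul_le_mul_of_nonneg_left b₁₀ c₄
  have m₅ := mul_le_mul_of_nonneg_left (add_le_add b₁₁ b₁₀) c₅
  have q₂ := mul_le_mul_of_nonneg_left (add_le_add (add_le_add m₁ m₂) m₃) (abs_nonneg u₂)
  have q₁ := mul_le_mul_of_nonneg_left (add_le_add m₄ m₅) (abs_nonneg u₁)
  have q₀ := mul_le_mul_of_nonneg_left b₀₀ (abs_nonneg u₀)
  linarith

/-! ### §4 (v2) The full sum `1 ≤ k ≤ D`: the transported `k = 1` term plus §3 -/

/-- **Brick 130's left side, assembled** (v2, eng g25). In the setting of `sum_abs_fwdDiff_iter_threeLaw_le`, if in addition the first difference obeys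
`c₁·|ΔF(0)| ≤ E₁` (`c₁ = C(2,1)/4 = ½`; this is the transported level step — prover g27's `ShellStep.levelStep_centredSecond_eq` with (B2)/(B3) — supplied as a
HYPOTHESIS here), then
`Σ_{k=1}^{D} c_k|Δ^kF(0)| ≤ E₁ + Σ_{k=2}^{D} [ |u₂|(T(T−2)/K·R₂(k) + 4k(T−2)/K·(R₂(k−1)+R₂(k)) + 8C(k,2)/K·(R₂(k−2)+2R₂(k−1)+R₂(k))) + |u₁|(T/K₁·R₁(k) + 2k/K₁·(R₁(k−1)+R₁(k))) + |u₀|R₀(k) ]`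
— the shape of hypothesis `(hA)` of brick 130's `gammaProfile_newton_eval_zero_ge_of_centred` once the right side is compared with `ε_A·F(0)` (variance floor (V)).
[cite: Boole2009, Ch. II Art. 10 Ex. 3 eq. (8) (PDF pp. 34–35)] -/
theorem sum_abs_fwdDiff_iter_threeLaw_le_of_one (F G₂ G₁ G₀ : ℕ → ℝ) (T K K₁ u₂ u₁ u₀ : ℝ) (hT : 2 ≤ T) (hK : 0 < K) (hK₁ : 0 < K₁)
    (D : ℕ) (hF : ∀ j, j ≤ D → F j =
      u₂ * (((T - 2 * (j : ℝ)) * (T - 2 - 2 * (j : ℝ))) / K) * G₂ j + u₁ * ((T - 2 * (j : ℝ)) / K₁) * G₁ j + u₀ * G₀ j)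
    (R₀ R₁ R₂ : ℕ → ℝ)
    (hR₀ : ∀ i, i ≤ D → (((2 * i).choose i : ℕ) : ℝ) / (4 : ℝ) ^ i * |(fwdDiff (1 : ℕ))^[i] G₀ 0| ≤ R₀ i)
    (hR₁ : ∀ i, i ≤ D → (((2 * i).choose i : ℕ) : ℝ) / (4 : ℝ) ^ i * |(fwdDiff (1 : ℕ))^[i] G₁ 0| ≤ R₁ i)
    (hR₂ : ∀ i, i ≤ D → (((2 * i).choose i : ℕ) : ℝ) / (4 : ℝ) ^ i * |(fwdDiff (1 : ℕ))^[i] G₂ 0| ≤ R₂ i)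
    {E₁ : ℝ} (h1 : (((2 * 1).choose 1 : ℕ) : ℝ) / (4 : ℝ) ^ 1 * |(fwdDiff (1 : ℕ))^[1] F 0| ≤ E₁) :
    ∑ k ∈ Ico 1 (D + 1), (((2 * k).choose k : ℕ) : ℝ) / (4 : ℝ) ^ k * |(fwdDiff (1 : ℕ))^[k] F 0| ≤
      E₁ + ∑ k ∈ Ico 2 (D + 1), (|u₂| * (T * (T - 2) / K * R₂ k + 4 * (k : ℝ) * (T - 2) / K * (R₂ (k - 1) + R₂ k)
          + 8 * ((k.choose 2 : ℕ) : ℝ) / K * (R₂ (k - 2) + 2 * R₂ (k - 1) + R₂ k))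
        + |u₁| * (T / K₁ * R₁ k + 2 * (k : ℝ) / K₁ * (R₁ (k - 1) + R₁ k)) + |u₀| * R₀ k) := by
  have hE₁ : 0 ≤ E₁ := le_trans (by positivity) h1
  rcases Nat.eq_zero_or_pos D with hD | hD
  · subst hD
    simp only [zero_add, Finset.Ico_self, sum_empty]
    have : Ico 2 1 = ∅ := by decide
    rw [this, sum_empty, add_zero]
    exact hE₁
  · rw [sum_eq_sum_Ico_succ_bot (by omega : 1 < D + 1)]
    have h2 := sum_abs_fwdDiff_iter_threeLaw_le F G₂ G₁ G₀ T K K₁ u₂ u₁ u₀ hT hK hK₁ D hF R₀ R₁ R₂ hR₀ hR₁ hR₂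
    linarith

end Summit.PneNP.PneNP.Theorems.ChebyshevTracialDesignGammaDirectionLeibnizBounds
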